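import Summits.AnomalousDissipation.AnomalousDissipation.Theorems.TaylorCertificatesFloorCertificateStubSublevelCompact
import Summits.AnomalousDissipation.AnomalousDissipation.Theorems.TaylorCertificatesFloorCertificateStubLscEnstrophy

/-!
# Stub `stub_sublevelCompactOn` (S1a) of line `registered`, crux `PumpedMirror.MirrorFloorTG`
# (stmt-AnomalousDissipation-15372)

DISSIPATION IS ITS OWN TIGHTNESS ON A CLOSED CARRIER. For a closed set `S ⊆ H = Torus.energySpace (Fin 3)`,
a radius `ρ` and a finite level `c`, the Borel probability measures on `H` carried by `S ∩ {|u|² ≤ ρ}` with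
mean enstrophy `≤ c` form a COMPACT subset of `ProbabilityMeasure H` (weak topology): a closed subset —
"carried by the closed set `S`" is closed under weak convergence by the portmanteau theorem
(`isClosed_setOf_ae_mem_of_isClosed`) — of the sibling crux FloorCertificate's compact dissipation
sublevel set `stub_sublevelCompact stub_lscEnstrophy ρ c` (Rellich + Markov + Prokhorov).

References: Foias–Manley–Rosa–Temam 2001, Ch. IV §1.2; Billingsley 1999, Thm 2.1 and Thm 5.1.
-/

set_option linter.dupNamespace false

noncomputable section

namespace Summit.AnomalousDissipation.AnomalousDissipation.Theorems.PumpedMirrorMirrorFloorTG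

open MeasureTheory Filter Topology Set
open scoped ENNReal NNReal
open Literature.Analysis.FunctionSpaces Literature.Analysis.FluidPDE
open Summit.AnomalousDissipation.AnomalousDissipation.Theorems.TaylorCertificatesFloorCertificate

/-- **S1a `stub_sublevelCompactOn`** — for a closed carrier `S ⊆ H`, a radius `ρ` and a finite level
`c`, the probability measures on the energy space carried by `S ∩ {|u|² ≤ ρ}` with mean enstrophy `≤ c`
form a compact subset of `ProbabilityMeasure H`: a closed subset (portmanteau on the closed `S`) of the
compact dissipation sublevel set of ball-carried measures (`stub_sublevelCompact stub_lscEnstrophy`).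
[cite: FMRTTurbulence2001, Ch. IV §1.2; BillingsleyCPM1999, Thm. 2.1] -/
theorem stub_sublevelCompactOn :
    ∀ (S : Set (Torus.energySpace (Fin 3))), IsClosed S → ∀ (ρ : ℝ) (c : ℝ≥0∞), c ≠ ⊤ →
      IsCompact {μ : ProbabilityMeasure (Torus.energySpace (Fin 3)) |
        (∀ᵐ u ∂(μ : Measure (Torus.energySpace (Fin 3))), ‖u‖ ^ 2 ≤ ρ) ∧
          (∀ᵐ u ∂(μ : Measure (Torus.energySpace (Fin 3))), u ∈ S) ∧
          Torus.ensembleEnstrophy (μ : Measure (Torus.energySpace (Fin 3))) ≤ c} := by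
  intro S hS ρ c hc
  have hK := stub_sublevelCompact stub_lscEnstrophy ρ c hc
  have hA : IsClosed {μ : ProbabilityMeasure (Torus.energySpace (Fin 3)) |
      ∀ᵐ u ∂(μ : Measure (Torus.energySpace (Fin 3))), u ∈ S} :=
    isClosed_setOf_ae_mem_of_isClosed hS
  refine (hK.inter_right hA).of_isClosed_subset ?_ ?_
  · have hball : IsClosed {u : Torus.energySpace (Fin 3) | ‖u‖ ^ 2 ≤ ρ} :=
      isClosed_le (by fun_prop) continuous_const
    have h1 : IsClosed {μ : ProbabilityMeasure (Torus.energySpace (Fin 3)) |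
        ∀ᵐ u ∂(μ : Measure (Torus.energySpace (Fin 3))), ‖u‖ ^ 2 ≤ ρ} :=
      isClosed_setOf_ae_mem_of_isClosed hball
    have h3 : IsClosed {μ : ProbabilityMeasure (Torus.energySpace (Fin 3)) |
        Torus.ensembleEnstrophy (μ : Measure (Torus.energySpace (Fin 3))) ≤ c} :=
      stub_lscEnstrophy.isClosed_preimage c
    simpa only [Set.setOf_and] using h1.inter (hA.inter h3)
  · rintro μ ⟨h1, h2, h3⟩
    exact ⟨⟨h1, h3⟩, h2⟩

end Summit.AnomalousDissipation.AnomalousDissipation.Theorems.PumpedMirrorMirrorFloorTG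

end
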